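import Summits.QuantumFields.BalabanUV.Beta.CompositeOneShotJetData
import Summits.QuantumFields.BalabanUV.Beta.BorderedHessianSymmetry
import Summits.QuantumFields.BalabanUV.Beta.TameKernelCalculus

/-!
# `BalabanUV.Beta.FP.TowerDoorDefectDefs` — binder row D1, the row's ONE file, THE DOOR's LATTICE DEFINITIONS, part 1 (J-NOTE-21 §4∕§5; v10 `FP/StepRecursionFeedNestedNamedI` (T2) `hWΔT`):
# **THE WARD-DEFECT KERNEL `DefKerℤ` OF A GAUGE FUNCTION AT A COARSE WINDOW, AND THE DOOR FAMILY `𝒲Δ` AS ITS SYMMETRISED READ-OUT SUPERPOSITION** — the LATTICE twins, term by term,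
# of (T2)'s torus word `Def(λ, β) = Σ_b (Dλ)_b • (M₂ n B) b β − κ₂ • (diag(λ∘·.1)·Ĉ_β − Ĉ_β·diag(λ∘·.1))` and of the door's right side `Σ_β (Ŝ_{a′} β • Def(λ_a) β + Ŝ_a β • Def(λ_{a′}) β)`,
# over an ABSTRACT table record `tabs : SymTables 3 L` (v10: `tabsComp (n+2) … (Pn.cM (n+2))`, `L = Lc^(n+2)`), an abstract gauge-function family `lam` (the row's: `λℤ` of PART 55) and an
# abstract read-out weight `S` (the row's: PART 46's `wΦ` column); the three `ff`-only∕swap letters of v10 (`hWΔm hWΔm′ hWΔs`) are then `rfl` ∕ `add_comm`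
# (β-function cell `pub-balaban`, BINDER-OWNERS row D1 ∕ (C1) OWNER «beta-an2» gen 77, PART 62)

WHY (located; J-NOTE-19 §3, J-NOTE-20 §3 (b), J-NOTE-21 §4–§5).  v10 displays the door `𝒲Δ : ℕ → Fin 4 → Site 4 → Fin 4 → Site 4 → MKer 4 (Fib 3)` as a B-FREE lattice family whose
source-wound torus table is (T2)'s word; every factor of that word is the periodisation of a lattice object: `Ŝ` = periodised `wΦ` (PART 47), `λ` = periodised `λℤ` (PART 57), `(M₂ n B) b β` =
`perF∘dper` of the `β`-periodised symmetrised mixed table `½(M2Of … mixFF 0 b.2 ↑b.1 β.2 · + sgnK (trK ·))` (v10 `hM₂`), `Ĉ_β` = `perF∘dper` of `tabs.H β.2 ↑β.1`, `tgrad` = the torus gradient.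
This file fixes the lattice side of the dictionary: the symmetrised mixed table `M2Z` at a (lattice fine bond, lattice coarse source), the defect kernel `defKerZ` (lattice gradient of the gauge
function against `M2Z`, minus `κ₂`× the commutator of the multiplication operator with `tabs.H`, on the `ff` legs only), and the door `doorZ` (the `S`-weighted symmetrised superposition over
the lattice windows `β`).  (T2) is then a periodisation identity about THESE objects (J-NOTE-21 §5; the row's next files), `hX` is `tadpole`'s linearity across `doorZ`'s superposition.

WHAT ([our object — bookkeeping] three `def`s + [folklore] unfoldings and the three letter shapes; kernel∕table∕weight-generic; no `def … : Prop`, nothing cited, 0 sorry, default heartbeats).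
* `M2Z L tabs bd β : MKer 4 (Fib 3)` := `½ • (M2Of 3 L tabs.mixFF 0 bd.2 bd.1 β.2 β.1 + sgnK (trK (M2Of 3 L tabs.mixFF 0 bd.2 bd.1 β.2 β.1)))` — v10 `hM₂`'s summand WITHOUT the `β`-translate sum.
* `defKerZ L tabs κ₂ v β : MKer 4 (Fib 3)` := on `(inl α, inl α′)`: `(Σ_κ Σ'_u (v (u + e_κ) − v u) · M2Z (u,κ) β x w α α′) − κ₂ · (v x · H_β x w α α′ − H_β x w α α′ · v w)`, `H_β := tabs.H β.2 β.1`; `0` on multiplier legs (the bond sum split as directions × sites, so that each direction's site series is a `wsum` for lit `biLoc_wsum`).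
* `doorZ L tabs κ₂ κΔ lam S μ y ν y′ : MKer 4 (Fib 3)` := `x w a b ↦ κΔ · Σ_κ Σ'_{y₀} (S ν y′ κ y₀ · defKerZ (lam μ y) (y₀,κ) x w a b + S μ y κ y₀ · defKerZ (lam ν y′) (y₀,κ) x w a b)` (`S ν z κ y₀` in p670056 §5's argument order).
* `defKerZ_inr_left ∕ _inr_right`, **`doorZ_inr_left ∕ doorZ_inr_right`** (v10's `hWΔm ∕ hWΔm′` shapes), **`doorZ_swap`** (v10's `hWΔs` shape: `doorZ … ν y′ μ y = doorZ … μ y ν y′`), `defKerZ_zero`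
  (the defect of the zero gauge function vanishes), `doorZ_apply_inl_inl`.
WHAT THIS IS NOT: not `hWΔ₂` (BiLoc — needs the tables' (Lmix)(LH) + PART 59), not `hX`, not (T2), not `hτ hτa`; no convergence is claimed for the two `tsum`s (definitions only); the row's INSTANCE
(`tabs := tabsComp (n+2) …`, `lam μ y := λℤ_(μ,y)` of PART 55 for `scaleK σ σ (AN R (n+1))`, `S ν y′ β := wΦ β.2 ν (β.1 − y′)`, `κ₂ κΔ` from v10's `κ₂ n`, `sn n·cM₂ n·r n`) is pinned in the next file;
nothing of Bałaban's asserted, valued or discharged; 0 estimates; 0∕4 row-D1 binders (hW, hR, D1Tel, D1Rep); v10 NOT filed; v9 p617999 stands; NOT (C1), NOT (T-ID), NOT D1, NEVER «G-an2-4 closed»,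
NOT BetaPertH, NOT continuum, NOT Clay.

HONEST DEPENDENCY (page 1, mandatory): continuum YM on T⁴ ⇐ BetaPertH ∧ nine spine estimates (0/9 proved); BetaPertH ⇐ (D1) ∧ (D4) ∧ CAP+tail;
G-an2-4 gates asym, D1 and NE2/3/4.  HONEST FRAMING (cell contract, verbatim): «discharging `BetaPertH` makes Bałaban's UV stability UNCONDITIONAL —
a real constructive-QFT result; it is NOT the continuum limit and NOT the Clay problem.»  ABSOLUTE RULE (cell charter, verbatim): «No internally-minted
statement may enter as a cited fact. Every hypothesis is either kernel-proved in this package or a verbatim quotation of a PUBLISHED theorem with page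
reference. The manuscript(s) under audit are NOT citable for their own disputed steps — they are the thing under adjudication; programme-internal
(2001/route/tribunal) claims are never citable.»  Row D1 ∕ (C1) OWNER «beta-an2» gen 77, 2026-08-29.  No existing file touched.
-/

noncomputable section

open Finset
open scoped BigOperators
open Literature.MathematicalPhysics.QuantumFieldTheory
open Literature.MathematicalPhysics.QuantumFieldTheory.Balaban1983to89
open Literature.MathematicalPhysics.QuantumFieldTheory.Balaban1983to89.Beta
open AffineAveraging (Site unitVec)
open OneStepResolventKernel (Fib)
open ExpKernelCalculus (MKer)
open BalabanStepW2 (M2Of)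
open Summit.QuantumFields.BalabanUV.Beta.SymmetrisedStepJets (SymTables)
open Summit.QuantumFields.BalabanUV.Beta.BorderedHessian (sgnK)
open Summit.QuantumFields.BalabanUV.Beta.TameKernelCalculus (trK)

namespace Summit.QuantumFields.BalabanUV.Beta.FP.TowerDoorDefectDefs

/-! ## §1 The three definitions -/

section Defs

variable (L : ℕ) (tabs : SymTables 3 L)

/-- [our object — bookkeeping] **THE SYMMETRISED MIXED TABLE AT A LATTICE FINE BOND `bd = (u, κ)` AND A LATTICE COARSE SOURCE `β = (w, ρ)`** — v10 `hM₂`'s summand without its `β`-translate sum: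
`½ • (M2Of 3 L tabs.mixFF 0 κ u ρ w + sgnK (trK (M2Of 3 L tabs.mixFF 0 κ u ρ w)))`. -/
def M2Z (bd β : Site (3 + 1) × Fin (3 + 1)) : MKer (3 + 1) (Fib 3) :=
  (1 / 2 : ℝ) • (M2Of 3 L tabs.mixFF 0 bd.2 bd.1 β.2 β.1 + sgnK (trK (M2Of 3 L tabs.mixFF 0 bd.2 bd.1 β.2 β.1)))

/-- [our object — bookkeeping] **THE WARD-DEFECT KERNEL OF THE GAUGE FUNCTION `v` AT THE COARSE WINDOW `β`** (lattice twin of (T2)'s `Def(λ, β)`): on the field legs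
`(Σ_κ Σ'_u (v (u + e_κ) − v u) · M2Z (u, κ) β x w) − κ₂ · (v x · H_β x w − H_β x w · v w)` with `H_β := tabs.H β.2 β.1` (the lattice gradient of `v` against the mixed table, minus `κ₂`× the
commutator of the multiplication operator `E_v` with the Hessian table); `0` on the multiplier legs (the door lives on the `ff` block). -/
def defKerZ (κ₂ : ℝ) (v : Site (3 + 1) → ℝ) (β : Site (3 + 1) × Fin (3 + 1)) : MKer (3 + 1) (Fib 3) :=
  fun x w a b => Sum.elim
    (fun α : Fin (3 + 1) => Sum.elim
      (fun α' : Fin (3 + 1) =>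
        (∑ κ : Fin (3 + 1), ∑' u : Site (3 + 1), (v (u + unitVec κ) - v u) * M2Z L tabs (u, κ) β x w (Sum.inl α) (Sum.inl α'))
          - κ₂ * (v x * tabs.H β.2 β.1 x w (Sum.inl α) (Sum.inl α') - tabs.H β.2 β.1 x w (Sum.inl α) (Sum.inl α') * v w))
      (fun _ : Fin (3 + 1) => (0 : ℝ)) b)
    (fun _ : Fin (3 + 1) => (0 : ℝ)) a

/-- [our object — bookkeeping] **THE DOOR FAMILY** over a gauge-function family `lam` (source leg, source site ↦ lattice gauge function) and a read-out weight `S ν z κ y₀` (source `(ν, z)`,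
window `(κ, y₀)` — the argument order of p670056 §5's letter `S j ν z κ y`):
`doorZ … μ y ν y′ x w a b := κΔ · Σ_κ Σ'_{y₀} (S ν y′ κ y₀ · defKerZ (lam μ y) (y₀,κ) x w a b + S μ y κ y₀ · defKerZ (lam ν y′) (y₀,κ) x w a b)` — the `S`-weighted, source-symmetrised
superposition of defect kernels, the window sum split as directions × sites exactly as the END's `hX` letter reads it (`Σ κ, Σ' y, …`). -/
def doorZ (κ₂ κΔ : ℝ) (lam : Fin (3 + 1) → Site (3 + 1) → (Site (3 + 1) → ℝ)) (S : Fin (3 + 1) → Site (3 + 1) → Fin (3 + 1) → Site (3 + 1) → ℝ)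
    (μ : Fin (3 + 1)) (y : Site (3 + 1)) (ν : Fin (3 + 1)) (y' : Site (3 + 1)) : MKer (3 + 1) (Fib 3) :=
  fun x w a b => κΔ * ∑ κ : Fin (3 + 1), ∑' y₀ : Site (3 + 1),
    (S ν y' κ y₀ * defKerZ L tabs κ₂ (lam μ y) (y₀, κ) x w a b + S μ y κ y₀ * defKerZ L tabs κ₂ (lam ν y') (y₀, κ) x w a b)

end Defs

/-! ## §2 Unfoldings and the three letter shapes -/

section Letters

variable (L : ℕ) (tabs : SymTables 3 L) (κ₂ κΔ : ℝ)

/-- [folklore] `M2Z` unfolded (`rfl`). -/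
theorem M2Z_eq (bd β : Site (3 + 1) × Fin (3 + 1)) : M2Z L tabs bd β
    = (1 / 2 : ℝ) • (M2Of 3 L tabs.mixFF 0 bd.2 bd.1 β.2 β.1 + sgnK (trK (M2Of 3 L tabs.mixFF 0 bd.2 bd.1 β.2 β.1))) := rfl

/-- [folklore] `defKerZ` on the field legs (`rfl`). -/
theorem defKerZ_apply_inl_inl (v : Site (3 + 1) → ℝ) (β : Site (3 + 1) × Fin (3 + 1)) (x w : Site (3 + 1)) (α α' : Fin (3 + 1)) :
    defKerZ L tabs κ₂ v β x w (Sum.inl α) (Sum.inl α')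
      = (∑ κ : Fin (3 + 1), ∑' u : Site (3 + 1), (v (u + unitVec κ) - v u) * M2Z L tabs (u, κ) β x w (Sum.inl α) (Sum.inl α'))
          - κ₂ * (v x * tabs.H β.2 β.1 x w (Sum.inl α) (Sum.inl α') - tabs.H β.2 β.1 x w (Sum.inl α) (Sum.inl α') * v w) := rfl

/-- [folklore] `defKerZ` has NO left multiplier leg (`rfl`). -/
theorem defKerZ_inr_left (v : Site (3 + 1) → ℝ) (β : Site (3 + 1) × Fin (3 + 1)) (x w : Site (3 + 1)) (m : Fin (3 + 1)) (b : Fib 3) :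
    defKerZ L tabs κ₂ v β x w (Sum.inr m) b = 0 := rfl

/-- [folklore] `defKerZ` has NO right multiplier leg. -/
theorem defKerZ_inr_right (v : Site (3 + 1) → ℝ) (β : Site (3 + 1) × Fin (3 + 1)) (x w : Site (3 + 1)) (a : Fib 3) (m : Fin (3 + 1)) :
    defKerZ L tabs κ₂ v β x w a (Sum.inr m) = 0 := by
  cases a <;> rfl

/-- [folklore] **the defect of the zero gauge function vanishes.** -/
theorem defKerZ_zero (β : Site (3 + 1) × Fin (3 + 1)) : defKerZ L tabs κ₂ (fun _ => (0 : ℝ)) β = fun _ _ _ _ => (0 : ℝ) := by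
  funext x w a b
  rcases a with α | m
  · rcases b with α' | m'
    · rw [defKerZ_apply_inl_inl]; simp
    · rfl
  · rfl

/-- [folklore] `doorZ` unfolded (`rfl`). -/
theorem doorZ_apply (lam : Fin (3 + 1) → Site (3 + 1) → (Site (3 + 1) → ℝ)) (S : Fin (3 + 1) → Site (3 + 1) → Fin (3 + 1) → Site (3 + 1) → ℝ)
    (μ : Fin (3 + 1)) (y : Site (3 + 1)) (ν : Fin (3 + 1)) (y' : Site (3 + 1)) (x w : Site (3 + 1)) (a b : Fib 3) :
    doorZ L tabs κ₂ κΔ lam S μ y ν y' x w a b = κΔ * ∑ κ : Fin (3 + 1), ∑' y₀ : Site (3 + 1),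
      (S ν y' κ y₀ * defKerZ L tabs κ₂ (lam μ y) (y₀, κ) x w a b + S μ y κ y₀ * defKerZ L tabs κ₂ (lam ν y') (y₀, κ) x w a b) := rfl

/-- [folklore] **`doorZ_inr_left` — v10's `hWΔm` shape**: the door has NO left multiplier leg. -/
theorem doorZ_inr_left (lam : Fin (3 + 1) → Site (3 + 1) → (Site (3 + 1) → ℝ)) (S : Fin (3 + 1) → Site (3 + 1) → Fin (3 + 1) → Site (3 + 1) → ℝ)
    (μ : Fin (3 + 1)) (y : Site (3 + 1)) (ν : Fin (3 + 1)) (y' : Site (3 + 1)) (x w : Site (3 + 1)) (m : Fin (3 + 1)) (b : Fib 3) :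
    doorZ L tabs κ₂ κΔ lam S μ y ν y' x w (Sum.inr m) b = 0 := by
  rw [doorZ_apply]
  simp [defKerZ_inr_left]

/-- [folklore] **`doorZ_inr_right` — v10's `hWΔm′` shape**: the door has NO right multiplier leg. -/
theorem doorZ_inr_right (lam : Fin (3 + 1) → Site (3 + 1) → (Site (3 + 1) → ℝ)) (S : Fin (3 + 1) → Site (3 + 1) → Fin (3 + 1) → Site (3 + 1) → ℝ)
    (μ : Fin (3 + 1)) (y : Site (3 + 1)) (ν : Fin (3 + 1)) (y' : Site (3 + 1)) (x w : Site (3 + 1)) (a : Fib 3) (m : Fin (3 + 1)) :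
    doorZ L tabs κ₂ κΔ lam S μ y ν y' x w a (Sum.inr m) = 0 := by
  rw [doorZ_apply]
  simp [defKerZ_inr_right]

/-- [folklore] **`doorZ_swap` — v10's `hWΔs` shape**: the door is symmetric under the exchange of its two sources: `doorZ … ν y′ μ y = doorZ … μ y ν y′` (`add_comm` under the window sum). -/
theorem doorZ_swap (lam : Fin (3 + 1) → Site (3 + 1) → (Site (3 + 1) → ℝ)) (S : Fin (3 + 1) → Site (3 + 1) → Fin (3 + 1) → Site (3 + 1) → ℝ)
    (μ : Fin (3 + 1)) (y : Site (3 + 1)) (ν : Fin (3 + 1)) (y' : Site (3 + 1)) :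
    doorZ L tabs κ₂ κΔ lam S ν y' μ y = doorZ L tabs κ₂ κΔ lam S μ y ν y' := by
  funext x w a b
  rw [doorZ_apply, doorZ_apply]
  congr 1
  exact Finset.sum_congr rfl fun κ _ => tsum_congr fun y₀ => add_comm _ _

end Letters

end Summit.QuantumFields.BalabanUV.Beta.FP.TowerDoorDefectDefs

end
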